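import Mathlib
import Summits.Ventures.PercRepro2.PointSplitBHK
import Summits.Ventures.PercRepro2.OneEdge

/-!
# The point split IS the root-edge Bernstein expansion of the BHK slack:
(PS) ∧ (PS1) ⟺ «the BHK slack is nonincreasing in every root-edge weight»
(blind cell PercRepro2, night-3 g23, 2026-08-28; `proofs/NIGHT3-CERT.md` §32.3)

Let `e = {u, t}` be an edge with `t ∈ X ∩ Y` (a ROOT edge of the `(X, Y)`-BHK form) and
`p⁰ = p[e := 0]`.  Opening `e` on `{s ↮ X}` forces `s ↮ u`, and then the cluster of `s` is
unchanged (`cluster_update_true_eq_of_avoid`, from typer-1's `conn_update_true_iff`), so for every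
cluster-determined weight `w`
`E_{p[e:=1]}[F·w·1_{s↮X}] = E_{p⁰}[F·w·1_{s↮X∪u}]` (`wExpect_update_one_eq`) and, pinning `e`,
`E_p[F·w·1_{s↮X}] = E_{p⁰}[F·w₀·1_{s↮X}] + (1 − p_e)·E_{p⁰}[F·w₁·1_{s↮X}]` with the point split
`w₀ = w·1_{u ∉ C_s}`, `w₁ = w·1_{u ∈ C_s}` (`wExpect_eq_split`).  Hence the BHK slack along `e` is

  **`S_w(p) = S_{w₀}(p⁰) + (1 − p_e)·M(w₀, w₁)(p⁰) + (1 − p_e)²·S_{w₁}(p⁰)`**  (`bhkFormW_rootEdge`),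

i.e. in Bernstein form `(1 − p_e)²·Φ₀₀ + p_e²·Φ₁₁ + p_e(1 − p_e)·M_e` with `Φ₀₀ = S_w(p⁰)`,
`Φ₁₁ = S_{w₀}(p⁰)` (u avoided) and `M_e = 2Φ₁₁ + M(w₀, w₁)` (`bhkFormW_rootEdge_bernstein`).
Consequently `dS/dp_e = −(M(w₀, w₁) + 2(1 − p_e)·S_{w₁})`, and the two point-split candidates of
`PointSplitBHK.lean` — (PS): `M(1_{uH}, 1_{ūH}) ≥ 0` and (PS1): `M(1_{uH}, 1) = M + 2S_{1_{uH}} ≥ 0`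
— say exactly that the BHK slack is NONINCREASING in the weight of every root edge
(`bhkForm_antitone_of_pointSplit`): `Φ₀₀ ≥ M_e/2 ≥ Φ₁₁`.  (3M) is the case `s = a₂`,
`X = Y = {a₁}`, `e = {v, a₁}`, `F = 1 − g`, `G = 1_{o ∈ ·}` (`ThreeMarkPointSplit.lean`), so
(3M) ⟺ «`M_e ≥ 2Φ₁₁` for the pair `(h, o)` at the root edge `{v, a₁}`» — compare g22's
MinRowBHK (`Φ₁₁ ≤ M_e`, §31.7).  Own work; standard axioms.
-/

namespace Summit.Ventures.PercRepro2

open UnionCluster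

namespace CovForm

namespace PointSplit

variable {V : Type*} {E : Type*} [Fintype E] [DecidableEq E]
  {R : Type*} [Field R] [LinearOrder R] [IsStrictOrderedRing R]

/-! ## Cluster-determined weights -/

/-- A weight on configurations that depends on `ω` only through the cluster of `s`. -/
def ClusterDet (ends : E → Sym2 V) (s : V) (w : Config E → R) : Prop :=
  ∀ ω ω' : Config E, cluster ends ω s = cluster ends ω' s → w ω = w ω'

omit [Fintype E] [DecidableEq E] [LinearOrder R] [IsStrictOrderedRing R] in
/-- The constant weight `1` is cluster-determined. -/
lemma clusterDet_one (ends : E → Sym2 V) (s : V) :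
    ClusterDet ends s (fun _ : Config E => (1 : R)) := fun _ _ _ => rfl

omit [Fintype E] [DecidableEq E] [LinearOrder R] [IsStrictOrderedRing R] in
/-- The point weight `1_{v ∈ C_s}` is cluster-determined. -/
lemma clusterDet_indicator_conn (ends : E → Sym2 V) (s v : V) :
    ClusterDet ends s ((connEvent ends s v).indicator (1 : Config E → R)) := by
  intro ω ω' h
  have hmem : ω ∈ connEvent ends s v ↔ ω' ∈ connEvent ends s v := by
    simp only [mem_connEvent, ← mem_cluster, h]
  by_cases hω : ω ∈ connEvent ends s v
  · rw [Set.indicator_of_mem hω, Set.indicator_of_mem (hmem.1 hω)]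
    rfl
  · rw [Set.indicator_of_notMem hω, Set.indicator_of_notMem (fun h' => hω (hmem.2 h'))]

omit [Fintype E] [DecidableEq E] [LinearOrder R] [IsStrictOrderedRing R] in
/-- The point weight `1_{v ∉ C_s}` is cluster-determined. -/
lemma clusterDet_indicator_conn_compl (ends : E → Sym2 V) (s v : V) :
    ClusterDet ends s (((connEvent ends s v)ᶜ).indicator (1 : Config E → R)) := by
  intro ω ω' h
  have hmem : ω ∈ connEvent ends s v ↔ ω' ∈ connEvent ends s v := by
    simp only [mem_connEvent, ← mem_cluster, h]
  by_cases hω : ω ∈ connEvent ends s v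
  · rw [Set.indicator_of_notMem (show ω ∉ (connEvent ends s v)ᶜ from fun h' => h' hω),
      Set.indicator_of_notMem (show ω' ∉ (connEvent ends s v)ᶜ from fun h' => h' (hmem.1 hω))]
  · rw [Set.indicator_of_mem (show ω ∈ (connEvent ends s v)ᶜ from hω),
      Set.indicator_of_mem (show ω' ∈ (connEvent ends s v)ᶜ from fun h' => hω (hmem.2 h'))]
    rfl

omit [Fintype E] [DecidableEq E] [LinearOrder R] [IsStrictOrderedRing R] in
/-- Products of cluster-determined weights are cluster-determined. -/
lemma ClusterDet.mul {ends : E → Sym2 V} {s : V} {w w' : Config E → R} (hw : ClusterDet ends s w)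
    (hw' : ClusterDet ends s w') : ClusterDet ends s (w * w') :=
  fun ω ω' h => by simp only [Pi.mul_apply, hw ω ω' h, hw' ω ω' h]

/-! ## Opening a root edge -/

omit [Fintype E] [LinearOrder R] [IsStrictOrderedRing R] in
/-- On `{s ↮ X ∪ {u}}` (evaluated with `e = {u, t}` closed, `t ∈ X`), opening `e` does not change
the cluster of `s`. -/
lemma cluster_update_true_eq_of_avoid [DecidableEq V] {ends : E → Sym2 V} {e : E} {u t : V}
    (hends : ends e = s(u, t)) {X : Finset V} (ht : t ∈ X) {s : V} {ω : Config E}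
    (h : Function.update ω e false ∈ avoidAll ends s (insert u X)) :
    cluster ends (Function.update ω e true) s = cluster ends (Function.update ω e false) s := by
  have hu : ¬ Conn ends (Function.update ω e false) s u := h u (Finset.mem_insert_self u X)
  have ht' : ¬ Conn ends (Function.update ω e false) s t := h t (Finset.mem_insert_of_mem ht)
  ext x
  simp only [mem_cluster]
  rw [show Function.update ω e true = Function.update (Function.update ω e false) e true from
    (Function.update_idem _ _ _).symm]
  rw [OneEdge.conn_update_true_iff hends]
  constructor
  · rintro (h1 | ⟨h2, _⟩ | ⟨h3, _⟩)
    · exact h1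
    · exact absurd h2 hu
    · exact absurd h3 ht'
  · intro h1
    exact Or.inl h1

omit [Fintype E] [LinearOrder R] [IsStrictOrderedRing R] in
/-- `ω[e ↦ open] ∈ {s ↮ X}` iff `ω[e ↦ closed] ∈ {s ↮ X ∪ {u}}`, for `e = {u, t}` with `t ∈ X`. -/
lemma update_true_mem_avoidAll_iff [DecidableEq V] {ends : E → Sym2 V} {e : E} {u t : V}
    (hends : ends e = s(u, t)) {X : Finset V} (ht : t ∈ X) {s : V} (ω : Config E) :
    Function.update ω e true ∈ avoidAll ends s X ↔
      Function.update ω e false ∈ avoidAll ends s (insert u X) := by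
  rw [show Function.update ω e true = Function.update (Function.update ω e false) e true from
    (Function.update_idem _ _ _).symm]
  set ω₀ := Function.update ω e false with hω₀
  constructor
  · intro h
    have key : ∀ x ∈ X, ¬ (Conn ends ω₀ s x ∨ (Conn ends ω₀ s u ∧ Conn ends ω₀ t x) ∨
        (Conn ends ω₀ s t ∧ Conn ends ω₀ u x)) := by
      intro x hx
      rw [← OneEdge.conn_update_true_iff hends]
      exact h x hx
    have hu : ¬ Conn ends ω₀ s u := by
      intro hsu
      exact key t ht (Or.inr (Or.inl ⟨hsu, conn_refl ends ω₀ t⟩))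
    intro x hx
    rcases Finset.mem_insert.1 hx with rfl | hx'
    · exact hu
    · exact fun hc => key x hx' (Or.inl hc)
  · intro h x hx
    rw [OneEdge.conn_update_true_iff hends]
    have hu : ¬ Conn ends ω₀ s u := h u (Finset.mem_insert_self u X)
    have ht' : ¬ Conn ends ω₀ s t := h t (Finset.mem_insert_of_mem ht)
    rintro (h1 | ⟨h2, _⟩ | ⟨h3, _⟩)
    · exact h x (Finset.mem_insert_of_mem hx) h1
    · exact hu h2
    · exact ht' h3

omit [LinearOrder R] [IsStrictOrderedRing R] in
/-- **Transfer**: for a root edge `e = {u, t}`, `t ∈ X`, and a cluster-determined weight,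
`E_{p[e:=1]}[F·w·1_{s↮X}] = E_{p[e:=0]}[F·w·1_{s↮X∪u}]`. -/
lemma wExpect_update_one_eq [DecidableEq V] (p : E → R) {ends : E → Sym2 V} {e : E} {u t : V}
    (hends : ends e = s(u, t)) {X : Finset V} (ht : t ∈ X) {s : V} (F : Set V → R)
    {w : Config E → R} (hw : ClusterDet ends s w) :
    wExpect (Function.update p e 1) ends s X F w =
      wExpect (Function.update p e 0) ends s (insert u X) F w := by
  unfold wExpect
  rw [expect_update_one, expect_update_zero]
  refine congrArg _ (funext fun ω => ?_)
  by_cases h : Function.update ω e false ∈ avoidAll ends s (insert u X)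
  · have hc := cluster_update_true_eq_of_avoid hends ht h
    rw [Set.indicator_of_mem ((update_true_mem_avoidAll_iff hends ht ω).2 h),
      Set.indicator_of_mem h, hc, hw _ _ hc]
    rfl
  · rw [Set.indicator_of_notMem (fun h' => h ((update_true_mem_avoidAll_iff hends ht ω).1 h')),
      Set.indicator_of_notMem h]
    simp

omit [LinearOrder R] [IsStrictOrderedRing R] in
/-- Avoiding `X ∪ {u}` is avoiding `X` with the weight `1_{u ∉ C_s}`. -/
lemma wExpect_insert [DecidableEq V] (p : E → R) (ends : E → Sym2 V) (s u : V) (X : Finset V) (F : Set V → R)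
    (w : Config E → R) :
    wExpect p ends s (insert u X) F w =
      wExpect p ends s X F (w * ((connEvent ends s u)ᶜ).indicator 1) := by
  unfold wExpect
  refine congrArg _ (funext fun ω => ?_)
  simp only [Pi.mul_apply]
  by_cases hu : ω ∈ connEvent ends s u
  · have h1 : ω ∉ avoidAll ends s (insert u X) := fun h => h u (Finset.mem_insert_self u X) hu
    rw [Set.indicator_of_notMem h1,
      Set.indicator_of_notMem (show ω ∉ (connEvent ends s u)ᶜ from fun h' => h' hu)]
    simp
  · rw [Set.indicator_of_mem (show ω ∈ (connEvent ends s u)ᶜ from hu)]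
    by_cases hX : ω ∈ avoidAll ends s X
    · have h2 : ω ∈ avoidAll ends s (insert u X) := by
        intro x hx
        rcases Finset.mem_insert.1 hx with rfl | hx'
        · exact hu
        · exact hX x hx'
      rw [Set.indicator_of_mem h2, Set.indicator_of_mem hX]
      simp
    · have h2 : ω ∉ avoidAll ends s (insert u X) :=
        fun h => hX fun x hx => h x (Finset.mem_insert_of_mem hx)
      rw [Set.indicator_of_notMem h2, Set.indicator_of_notMem hX]
      simp

omit [LinearOrder R] [IsStrictOrderedRing R] in
/-- Pinning the edge `e` in `wExpect`. -/
lemma wExpect_pin (p : E → R) (ends : E → Sym2 V) (s : V) (X : Finset V) (F : Set V → R)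
    (w : Config E → R) (e : E) :
    wExpect p ends s X F w =
      p e * wExpect (Function.update p e 1) ends s X F w +
        (1 - p e) * wExpect (Function.update p e 0) ends s X F w := by
  unfold wExpect
  exact expect_eq_pin p _ e

omit [LinearOrder R] [IsStrictOrderedRing R] in
/-- Scalars come out of `wExpect`. -/
lemma wExpect_smul (p : E → R) (ends : E → Sym2 V) (s : V) (X : Finset V) (F : Set V → R)
    (c : R) (w : Config E → R) :
    wExpect p ends s X F (fun ω => c * w ω) = c * wExpect p ends s X F w := by
  unfold wExpect
  rw [← expect_const_mul]
  refine congrArg _ (funext fun ω => ?_)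
  ring

omit [LinearOrder R] [IsStrictOrderedRing R] in
/-- **The point split at `u` along a root edge** `e = {u, t}`, `t ∈ X`: with
`w₀ = w·1_{u ∉ C_s}`, `w₁ = w·1_{u ∈ C_s}` and `p⁰ = p[e := 0]`,
`E_p[F·w·1_{s↮X}] = E_{p⁰}[F·w₀·1_{s↮X}] + (1 − p_e)·E_{p⁰}[F·w₁·1_{s↮X}]`. -/
lemma wExpect_eq_split [DecidableEq V] (p : E → R) {ends : E → Sym2 V} {e : E} {u t : V}
    (hends : ends e = s(u, t)) {X : Finset V} (ht : t ∈ X) {s : V} (F : Set V → R)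
    {w : Config E → R} (hw : ClusterDet ends s w) :
    wExpect p ends s X F w =
      wExpect (Function.update p e 0) ends s X F (w * ((connEvent ends s u)ᶜ).indicator 1) +
        (1 - p e) * wExpect (Function.update p e 0) ends s X F
          (w * (connEvent ends s u).indicator 1) := by
  rw [wExpect_pin p ends s X F w e, wExpect_update_one_eq p hends ht F hw, wExpect_insert]
  have hsplit : wExpect (Function.update p e 0) ends s X F w =
      wExpect (Function.update p e 0) ends s X F (w * ((connEvent ends s u)ᶜ).indicator 1) +
        wExpect (Function.update p e 0) ends s X F (w * (connEvent ends s u).indicator 1) := by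
    rw [← wExpect_add]
    congr 1
    funext ω
    simp only [Pi.add_apply, Pi.mul_apply]
    by_cases h : ω ∈ connEvent ends s u
    · rw [Set.indicator_of_mem h,
        Set.indicator_of_notMem (show ω ∉ (connEvent ends s u)ᶜ from fun h' => h' h)]
      simp
    · rw [Set.indicator_of_notMem h, Set.indicator_of_mem (show ω ∈ (connEvent ends s u)ᶜ from h)]
      simp
  rw [hsplit]
  ring

/-! ## The BHK slack along a root edge -/

omit [LinearOrder R] [IsStrictOrderedRing R] in
/-- **The BHK slack along a root edge** `e = {u, t}`, `t ∈ X ∩ Y`, for a cluster-determined weight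
`w`: `S_w(p) = S_{w₀}(p⁰) + (1 − p_e)·M(w₀, w₁)(p⁰) + (1 − p_e)²·S_{w₁}(p⁰)`. -/
theorem bhkFormW_rootEdge [DecidableEq V] (p : E → R) {ends : E → Sym2 V} {e : E} {u t : V}
    (hends : ends e = s(u, t)) {X Y : Finset V} (htX : t ∈ X) (htY : t ∈ Y) {s : V}
    (F G : Set V → R) {w : Config E → R} (hw : ClusterDet ends s w) :
    bhkFormW p ends s X Y F G w =
      bhkFormW (Function.update p e 0) ends s X Y F G
          (w * ((connEvent ends s u)ᶜ).indicator 1) +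
        (1 - p e) * mixedFormW (Function.update p e 0) ends s X Y F G
          (w * ((connEvent ends s u)ᶜ).indicator 1) (w * (connEvent ends s u).indicator 1) +
        (1 - p e) ^ 2 * bhkFormW (Function.update p e 0) ends s X Y F G
          (w * (connEvent ends s u).indicator 1) := by
  have htZ : t ∈ X ∩ Y := Finset.mem_inter.2 ⟨htX, htY⟩
  have htU : t ∈ X ∪ Y := Finset.mem_union_left Y htX
  unfold bhkFormW mixedFormW
  rw [wExpect_eq_split p hends htZ _ hw, wExpect_eq_split p hends htU _ hw,
    wExpect_eq_split p hends htX _ hw, wExpect_eq_split p hends htY _ hw]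
  ring

omit [LinearOrder R] [IsStrictOrderedRing R] in
/-- The same in Bernstein form: `(1 − p_e)²·Φ₀₀ + p_e²·Φ₁₁ + p_e(1 − p_e)·M_e` with
`Φ₀₀ = S_w(p⁰)`, `Φ₁₁ = S_{w₀}(p⁰)` and `M_e = 2Φ₁₁ + M(w₀, w₁)(p⁰)`. -/
theorem bhkFormW_rootEdge_bernstein [DecidableEq V] (p : E → R) {ends : E → Sym2 V} {e : E}
    {u t : V} (hends : ends e = s(u, t)) {X Y : Finset V} (htX : t ∈ X) (htY : t ∈ Y) {s : V}
    (F G : Set V → R) {w : Config E → R} (hw : ClusterDet ends s w) :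
    bhkFormW p ends s X Y F G w =
      (1 - p e) ^ 2 * bhkFormW (Function.update p e 0) ends s X Y F G w +
        (p e) ^ 2 * bhkFormW (Function.update p e 0) ends s X Y F G
          (w * ((connEvent ends s u)ᶜ).indicator 1) +
        p e * (1 - p e) * (2 * bhkFormW (Function.update p e 0) ends s X Y F G
            (w * ((connEvent ends s u)ᶜ).indicator 1) +
          mixedFormW (Function.update p e 0) ends s X Y F G
            (w * ((connEvent ends s u)ᶜ).indicator 1) (w * (connEvent ends s u).indicator 1)) := by
  rw [bhkFormW_rootEdge p hends htX htY F G hw]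
  have hsplit : w = w * ((connEvent ends s u)ᶜ).indicator 1 + w * (connEvent ends s u).indicator 1 := by
    funext ω
    simp only [Pi.add_apply, Pi.mul_apply]
    by_cases h : ω ∈ connEvent ends s u
    · rw [Set.indicator_of_mem h,
        Set.indicator_of_notMem (show ω ∉ (connEvent ends s u)ᶜ from fun h' => h' h)]
      simp
    · rw [Set.indicator_of_notMem h, Set.indicator_of_mem (show ω ∈ (connEvent ends s u)ᶜ from h)]
      simp
  have hS : bhkFormW (Function.update p e 0) ends s X Y F G w =
      bhkFormW (Function.update p e 0) ends s X Y F G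
          (w * ((connEvent ends s u)ᶜ).indicator 1) +
        bhkFormW (Function.update p e 0) ends s X Y F G (w * (connEvent ends s u).indicator 1) +
        mixedFormW (Function.update p e 0) ends s X Y F G
          (w * ((connEvent ends s u)ᶜ).indicator 1) (w * (connEvent ends s u).indicator 1) := by
    conv_lhs => rw [hsplit]
    exact bhkFormW_add _ _ _ _ _ _ _ _ _
  rw [hS]
  ring

/-! ## Monotonicity in the root-edge weight from the point-split candidates -/

omit [LinearOrder R] [IsStrictOrderedRing R] in
/-- Along a root edge, `S(p[e := y]) − S(p[e := x]) = (x − y)·(M + (2 − x − y)·S_{w₁})`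
(the forms on the right at `p[e := 0]`). -/
lemma bhkFormW_update_sub [DecidableEq V] (p : E → R) {ends : E → Sym2 V} {e : E} {u t : V}
    (hends : ends e = s(u, t)) {X Y : Finset V} (htX : t ∈ X) (htY : t ∈ Y) {s : V}
    (F G : Set V → R) {w : Config E → R} (hw : ClusterDet ends s w) (x y : R) :
    bhkFormW (Function.update p e y) ends s X Y F G w -
        bhkFormW (Function.update p e x) ends s X Y F G w =
      (x - y) * (mixedFormW (Function.update p e 0) ends s X Y F G
          (w * ((connEvent ends s u)ᶜ).indicator 1) (w * (connEvent ends s u).indicator 1) +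
        (2 - x - y) * bhkFormW (Function.update p e 0) ends s X Y F G
          (w * (connEvent ends s u).indicator 1)) := by
  rw [bhkFormW_rootEdge (Function.update p e y) hends htX htY F G hw,
    bhkFormW_rootEdge (Function.update p e x) hends htX htY F G hw]
  simp only [Function.update_idem, Function.update_self]
  ring

/-- **Root-edge monotonicity of the BHK slack from (PS) ∧ (PS1)**: if `M(1_{uH}, 1_{ūH}) ≥ 0` and
`M(1_{uH}, 1) ≥ 0` at `p[e := 0]`, the BHK slack `S_1` is nonincreasing in the weight of the root
edge `e = {u, t}`, `t ∈ X ∩ Y`, on `[0, 1]`. -/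
theorem bhkForm_antitone_of_pointSplit [DecidableEq V] (p : E → R) {ends : E → Sym2 V} {e : E}
    {u t : V} (hends : ends e = s(u, t)) {X Y : Finset V} (htX : t ∈ X) (htY : t ∈ Y) {s : V}
    (F G : Set V → R)
    (hPS : 0 ≤ mixedFormW (Function.update p e 0) ends s X Y F G
      ((connEvent ends s u).indicator 1) (((connEvent ends s u)ᶜ).indicator 1))
    (hPS1 : 0 ≤ mixedFormW (Function.update p e 0) ends s X Y F G
      ((connEvent ends s u).indicator 1) (fun _ => 1))
    {x y : R} (hx : 0 ≤ x) (hxy : x ≤ y) (hy : y ≤ 1) :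
    bhkFormW (Function.update p e y) ends s X Y F G (fun _ => 1) ≤
      bhkFormW (Function.update p e x) ends s X Y F G (fun _ => 1) := by
  have hd := bhkFormW_update_sub p hends htX htY F G (clusterDet_one ends s) x y
  have e0 : (fun _ : Config E => (1 : R)) * ((connEvent ends s u)ᶜ).indicator 1 =
      ((connEvent ends s u)ᶜ).indicator 1 := by
    funext ω; simp
  have e1 : (fun _ : Config E => (1 : R)) * (connEvent ends s u).indicator 1 =
      (connEvent ends s u).indicator 1 := by
    funext ω; simp
  rw [e0, e1, mixedFormW_comm] at hd
  rw [mixedForm_one_eq] at hPS1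
  -- `M + (2 − x − y)·S₁ = (1 − c)·M + c·(M + 2S₁)` with `c = (2 − x − y)/2 ∈ [0, 1]`
  have hc0 : 0 ≤ 2 - x - y := by linarith
  have hc1 : 2 - x - y ≤ 2 := by linarith
  have key : 0 ≤ mixedFormW (Function.update p e 0) ends s X Y F G
      ((connEvent ends s u).indicator 1) (((connEvent ends s u)ᶜ).indicator 1) +
      (2 - x - y) * bhkFormW (Function.update p e 0) ends s X Y F G
        ((connEvent ends s u).indicator 1) := by
    nlinarith [hPS, hPS1, hc0, hc1]
  have hxy' : 0 ≤ x - y ∨ x - y ≤ 0 := Or.inr (by linarith)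
  have : bhkFormW (Function.update p e y) ends s X Y F G (fun _ => 1) -
      bhkFormW (Function.update p e x) ends s X Y F G (fun _ => 1) ≤ 0 := by
    rw [hd]
    exact mul_nonpos_of_nonpos_of_nonneg (by linarith) key
  linarith

/-- **(PS) ∧ (PS1) at the source `s` ⟹ the BHK slack of every pair of nonnegative monotone
functionals is nonincreasing in every root-edge weight** (for product laws). -/
theorem bhkForm_antitone_of_candidates [DecidableEq V] (ends : E → Sym2 V) (s : V)
    (hPS : PointSplitBHK (R := R) ends s) (hPS1 : PointSplitBHKOne (R := R) ends s)
    (p : E → R) (hp : IsProbVec p) {e : E} {u t : V} (hends : ends e = s(u, t)) {X Y : Finset V}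
    (htX : t ∈ X) (htY : t ∈ Y) {F G : Set V → R} (hF : Monotone F) (hG : Monotone G)
    (hF0 : ∀ S, 0 ≤ F S) (hG0 : ∀ S, 0 ≤ G S) {x y : R} (hx : 0 ≤ x) (hxy : x ≤ y)
    (hy : y ≤ 1) :
    bhkFormW (Function.update p e y) ends s X Y F G (fun _ => 1) ≤
      bhkFormW (Function.update p e x) ends s X Y F G (fun _ => 1) := by
  have hp0 : IsProbVec (Function.update p e 0) := hp.update e le_rfl zero_le_one
  exact bhkForm_antitone_of_pointSplit p hends htX htY F G
    (hPS _ hp0 X Y u F G hF hG hF0 hG0) (hPS1 _ hp0 X Y u F G hF hG hF0 hG0) hx hxy hy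

end PointSplit

end CovForm

end Summit.Ventures.PercRepro2
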